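import Summits.ResolutionOfSingularities.ResolutionOfSingularities.Theorems.FrobeniusClosingPatchingRelPerfectDepthPhaseCAtlasP
import Literature.AlgebraicGeometry.Resolution.RegularLocalRingsUFD
import Literature.AlgebraicGeometry.Resolution.EffectiveCartierStalks
import Literature.AlgebraicGeometry.Resolution.RegularBlowup
import Literature.AlgebraicGeometry.Resolution.ExcellentBlowup
import Literature.AlgebraicGeometry.Resolution.HypersurfaceTransform
import Literature.AlgebraicGeometry.Resolution.MonomialMarkedIdeals
import Literature.AlgebraicGeometry.Hironaka2017.Proofs.S16Proof.Eq130c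
import HarnessLib

/-!
# Crux `PatchingRelPerfect` (stmt-ResolutionOfSingularities-16161), chain W5.2 — F7(β) (β-AX) X3 C-I: the AMBIENT and HOST clauses of
# the pole atlas `CylReach` (targets v7 `ChainW52TargetsF7BetaRP`)

[OURS · L1 W5.2 · F7(β) (β-AX) X3 C-I · res-L1-w52-plan-1 NAMING G12-26 (hand res-D-pv-021 g9); pattern of res-L1-w52-lead-1΄s
`…DepthPhaseCReachBasic` §0 (`atlasInitial_<P>` + `stepStable_<P>` ⇒ `CylReach.<P>` by `CylReach.induct`).]  Replaces the role of NO
printed item; NOT a statement of the manuscript under review; fact-free.  AI-written; AI review is weaker than expert review.  No definitions.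

* §1 AMBIENT: **`CylReach.isNoetherian`** (a blow-up of a Noetherian scheme is Noetherian: locally Noetherian + quasi-compact over compact),
  **`CylReach.isExcellent`** (`IsBlowup.isExcellent`).  (`CylReach.isRegular` is res-L1-w52-lead-1΄s, `…DepthPhaseCReachNDom`; regularity is
  re-derived PRIVATELY inside §3΄s joint step and not exported.)
* §2 STALKWISE PRINCIPALITY SURVIVES CONTROLLED TRANSFORMS: **`IsBlowup.exists_stalkIdeal_controlledTransform_eq_span`** (the UFD colon
  lemma «`((a) : b)` principal» is the tree΄s folklore `Eq130Proof.exists_colon_span_singleton_eq_span`, Matsumura Thm. 20.3 calculus —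
  imported by the gate΄s dedup rule; nothing of the manuscript under adjudication is used): for a blow-up `π : X′ → X` along `C` with `X′` REGULAR and `H` stalkwise
  principal, every controlled transform `πᶜ(H, μ) = (π^*H : (C𝒪)^μ)` is stalkwise principal — its stalk at `x′` is `((φ v) : e^μ)` with `e` a
  local equation of the exceptional divisor, a colon of principal ideals in the UFD `𝒪_{X′,x′}` (Auslander–Buchsbaum).  No order hypothesis.
* §3 HOSTS: **`CylReach.hostsPrincipal : ∀ i x, ∃ v, stalkIdeal (S.host i) x = span {v}`** — initially `cyl.V = ⊤` and
  `host i|_V = q^*(tr i)` with `tr i` effective Cartier; the step is `host′ i = τᶜ(host i, m i)` (`step_host`) on the regular blow-up.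
  Consumers: PC-1΄s `hHV` (`…DepthPhaseCPoleChart`), stub-1΄s layer C, the letter systems (G2)/(M2b), lead-1΄s assembly.

## References
* H. Matsumura, *Commutative Ring Theory* (1987), Thm. 20.3 (regular local rings are UFDs). [Matsumura1987]
* U. Görtz, T. Wedhorn, *Algebraic Geometry I* (2nd ed., 2020), Prop. 13.91, Def. 13.90 (blow-ups: proper, exceptional divisor Cartier).
  [GortzWedhorn2020]
* E. Bierstone, D. Grigoriev, P. Milman, J. Włodarczyk (2011), Def. 3.1.3 (3) (controlled transform). [BierstoneGrigorievMilmanWlodarczyk2011]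
-/

-- `Summit.<Summit>.<Sub>.Theorems` with `Sub = Summit` (single-conjunct summit, D-0017)
set_option linter.dupNamespace false

noncomputable section

open CategoryTheory AlgebraicGeometry TopologicalSpace IsLocalRing
open Literature.AlgebraicGeometry.Resolution
open Literature.AlgebraicGeometry.Hironaka2017.MonomialPart
open Scheme.IdealSheafData

namespace Summit.ResolutionOfSingularities.ResolutionOfSingularities.Theorems

universe u

namespace ChainW52F7BetaRP

open DepthMultiHost

/-! ## §1 Ambient clauses: Noetherian, excellent -/

/-- [OURS · L1 W5.2] The generation-zero ambient scheme is Noetherian (binder of `AtlasInitial`). [folklore] -/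
theorem atlasInitial_isNoetherian : AtlasInitial (fun X _ _ => IsNoetherian X) :=
  fun _ hN _ _ _ _ _ _ _ _ _ _ _ _ => hN

/-- [OURS · L1 W5.2] **Noetherianity is step-stable**: the lifted cylinder step is a blow-up `τ : X′ → X` (proper, hence quasi-compact) of a
Noetherian scheme with `X′` locally Noetherian. [cite: GortzWedhorn2020, Prop. 13.91] -/
theorem stepStable_isNoetherian : StepStable (fun X _ _ => IsNoetherian X) := by
  intro X X' _ _ S cyl _ _ C hC0 hCreg hCrad 𝓑 h𝓑 h𝓑C D hD hsub hBsing hperm τ hτ η hη m hm hm' hsncX cyl' τZ hτZ hsq hker htr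
    hbd hbdF hV' hlow h
  haveI : IsNoetherian X := h
  haveI : IsProper τ := hτ.isProper
  haveI : CompactSpace X' := QuasiCompact.compactSpace_of_compactSpace τ
  exact {}

/-- [OURS · L1 W5.2] **Reachable ambient schemes are Noetherian.** [folklore] -/
theorem CylReach.isNoetherian {X : Scheme.{u}} {S : MultiHostState X} {cyl : CylState S} (h : CylReach S cyl) : IsNoetherian X :=
  h.induct stepStable_isNoetherian atlasInitial_isNoetherian

/-- [OURS · L1 W5.2] The generation-zero ambient scheme is excellent (binder of `AtlasInitial`). [folklore] -/
theorem atlasInitial_isExcellent : AtlasInitial (fun X _ _ => Scheme.IsExcellent X) :=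
  fun _ _ _ _ _ _ _ _ _ _ _ hXexc _ _ => hXexc

/-- [OURS · L1 W5.2] **Excellence is step-stable**: blow-ups of excellent schemes are excellent (`IsBlowup.isExcellent`).
[cite: GortzWedhorn2020, Prop. 13.91] -/
theorem stepStable_isExcellent : StepStable (fun X _ _ => Scheme.IsExcellent X) := by
  intro X X' _ _ S cyl _ _ C hC0 hCreg hCrad 𝓑 h𝓑 h𝓑C D hD hsub hBsing hperm τ hτ η hη m hm hm' hsncX cyl' τZ hτZ hsq hker htr
    hbd hbdF hV' hlow h
  exact hτ.isExcellent h

/-- [OURS · L1 W5.2] **Reachable ambient schemes are excellent.** [folklore] -/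
theorem CylReach.isExcellent {X : Scheme.{u}} {S : MultiHostState X} {cyl : CylState S} (h : CylReach S cyl) : Scheme.IsExcellent X :=
  h.induct stepStable_isExcellent atlasInitial_isExcellent

/-! ## §2 Stalkwise principality survives controlled transforms on a regular blow-up -/

/-- **Stalkwise principality survives controlled transforms on a regular blow-up.**  For a blow-up `π : X′ → X` along `C` with `X′`
regular and an ideal `H` with principal stalks, every controlled transform `πᶜ(H, μ) = (π^*H : (C·𝒪_{X′})^μ)` has principal stalks: at
`x′` its stalk is the colon `((φ v) : e^μ)` of principal ideals (`e` a local equation of the exceptional divisor, a non-zero-divisor), and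
`𝒪_{X′,x′}` is a UFD (Auslander–Buchsbaum).  No hypothesis on orders. [cite: Matsumura1987, Thm. 20.3] [cite: GortzWedhorn2020, Def. 13.90]
[cite: BierstoneGrigorievMilmanWlodarczyk2011, Def. 3.1.3 (3)] -/
theorem IsBlowup.exists_stalkIdeal_controlledTransform_eq_span {X X' : Scheme.{u}} [IsLocallyNoetherian X'] {π : X' ⟶ X}
    {C : X.IdealSheafData} (hπ : IsBlowup π C) (hX' : Scheme.IsRegular X') {H : X.IdealSheafData}
    (hH : ∀ x : X, ∃ v : X.presheaf.stalk x, stalkIdeal H x = Ideal.span {v}) (μ : ℕ) (x' : X') :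
    ∃ w : X'.presheaf.stalk x', stalkIdeal (controlledTransform π C H μ) x' = Ideal.span {w} := by
  classical
  haveI : IsRegularLocalRing (X'.presheaf.stalk x') := hX' x'
  haveI := isDomain_of_isRegularLocalRing (X'.presheaf.stalk x')
  haveI : UniqueFactorizationMonoid (X'.presheaf.stalk x') := IsRegularLocalRing.uniqueFactorizationMonoid _
  obtain ⟨v, hv⟩ := hH (π x')
  obtain ⟨e, he, hCe⟩ := (mem_cartierLocus_iff _ _).mp (hπ.isEffectiveCartier.mem_cartierLocus x')
  have hst : stalkIdeal (controlledTransform π C H μ) x' =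
      (Ideal.span {(π.stalkMap x').hom v}).colon ({e ^ μ} : Set (X'.presheaf.stalk x')) := by
    rw [controlledTransform, stalkIdeal_colon, stalkIdeal_pow, stalkIdeal_comap_eq_map_stalkMap, hv, Ideal.map_span,
      Set.image_singleton, hCe, Ideal.span_singleton_pow]
    exact Submodule.colon_span
  obtain ⟨c, hc⟩ := Literature.AlgebraicGeometry.Hironaka2017.S16Proof.Eq130Proof.exists_colon_span_singleton_eq_span
    ((π.stalkMap x').hom v) (e ^ μ)
    (pow_ne_zero μ (nonZeroDivisors.ne_zero he))
  exact ⟨c, hst.trans hc⟩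

/-! ## §3 Host clause: hosts are stalkwise principal -/

/-- The host clause (with the regularity of the ambient scheme carried along for the step). -/
private theorem atlasInitial_isRegular_and_hostsPrincipal :
    AtlasInitial (fun X S _ => Scheme.IsRegular X ∧ ∀ (i : Fin S.n) (x : X), ∃ v : X.presheaf.stalk x,
      stalkIdeal (S.host i) x = Ideal.span {v}) := by
  intro X _ St cyl _ _ hV hZreg hZexc hZdim h𝓔 hXexc hn hshape
  obtain ⟨R, _, _, _, _, _, _, _, _, _, _, _, _, _, _, g, i, hinv, -⟩ := hshape
  refine ⟨hinv.isRegular, fun k x => ?_⟩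
  -- `x` lies in the cylinder region `cyl.V = ⊤`; there `host k|_V = q^*(tr k)` with `tr k` effective Cartier
  have hxV : x ∈ cyl.V := by rw [hV]; trivial
  let y : ↥cyl.V := ⟨x, hxV⟩
  obtain ⟨t, -, ht⟩ := (mem_cartierLocus_iff _ _).mp ((cyl.tr_isEffectiveCartier k).mem_cartierLocus (cyl.q y))
  have h1 : stalkIdeal ((St.host k).comap cyl.V.ι) y = Ideal.span {(cyl.q.stalkMap y).hom t} := by
    rw [cyl.host_eq k, stalkIdeal_comap_eq_map_stalkMap, ht, Ideal.map_span, Set.image_singleton]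
  -- descend along the open immersion `V.ι` (iso on stalks)
  have hbij : Function.Bijective (cyl.V.ι.stalkMap y).hom := ConcreteCategory.bijective_of_isIso (cyl.V.ι.stalkMap y)
  obtain ⟨w₀, hw₀⟩ := hbij.2 ((cyl.q.stalkMap y).hom t)
  refine ⟨w₀, ?_⟩
  have h2 : (stalkIdeal (St.host k) (cyl.V.ι y)).map (cyl.V.ι.stalkMap y).hom =
      (Ideal.span {w₀}).map (cyl.V.ι.stalkMap y).hom := by
    rw [← stalkIdeal_comap_eq_map_stalkMap, h1, Ideal.map_span, Set.image_singleton, hw₀]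
  have h3 := congrArg (Ideal.comap (cyl.V.ι.stalkMap y).hom) h2
  rw [Ideal.comap_map_of_bijective _ hbij, Ideal.comap_map_of_bijective _ hbij] at h3
  exact h3

/-- The joint step: regularity by `IsBlowup.isRegular_of_isRegular_subscheme` (the pushed centre is a stratum-type regular subscheme,
`HasSNCWith.isRegular_subscheme`), the hosts by `step_host` + `IsBlowup.exists_stalkIdeal_controlledTransform_eq_span`. -/
private theorem stepStable_isRegular_and_hostsPrincipal :
    StepStable (fun X S _ => Scheme.IsRegular X ∧ ∀ (i : Fin S.n) (x : X), ∃ v : X.presheaf.stalk x,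
      stalkIdeal (S.host i) x = Ideal.span {v}) := by
  intro X X' _ _ S cyl _ _ C hC0 hCreg hCrad 𝓑 h𝓑 h𝓑C D hD hsub hBsing hperm τ hτ η hη m hm hm' hsncX cyl' τZ hτZ hsq hker htr
    hbd hbdF hV' hlow h
  obtain ⟨hX, hhost⟩ := h
  have hX' : Scheme.IsRegular X' := hτ.isRegular_of_isRegular_subscheme hX hsncX.isRegular_subscheme
  refine ⟨hX', fun i x' => ?_⟩
  rw [MultiHostState.step_host]
  exact IsBlowup.exists_stalkIdeal_controlledTransform_eq_span hτ hX' (hhost i) (m i) x'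

/-- [OURS · L1 W5.2] **HOSTS OF REACHABLE STATES ARE STALKWISE PRINCIPAL**: `∀ i x, (host i)_x = (v)` — initially from the cylinder
identity `host i|_V = q^*(tr i)` on `cyl.V = ⊤` (`tr i` effective Cartier), and preserved by every lifted cylinder step
(`host′ i = τᶜ(host i, m i)` on the regular blow-up; §2).  The `hHV` input of PC-1 `MultiHostState.exists_generator_step_host`.
[cite: Matsumura1987, Thm. 20.3] [cite: BierstoneGrigorievMilmanWlodarczyk2011, Def. 3.1.3 (3)] -/
theorem CylReach.hostsPrincipal {X : Scheme.{u}} {S : MultiHostState X} {cyl : CylState S} (h : CylReach S cyl) :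
    ∀ (i : Fin S.n) (x : X), ∃ v : X.presheaf.stalk x, stalkIdeal (S.host i) x = Ideal.span {v} :=
  (h.induct stepStable_isRegular_and_hostsPrincipal atlasInitial_isRegular_and_hostsPrincipal).2

end ChainW52F7BetaRP

end Summit.ResolutionOfSingularities.ResolutionOfSingularities.Theorems

end
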